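import Mathlib
import HarnessLib
import Literature.Probability.MarkovChains.MetropolisHastings
import Literature.Probability.MarkovChains.TotalVariation
import Summits.Ventures.LatticeQCDFlow.Exactness.JarzynskiFinite
import Summits.Ventures.LatticeQCDFlow.Exactness.LocalUpdates
import Summits.Ventures.LatticeQCDFlow.Scaling.StochasticFlows

/-!
# The expanded-ensemble chain of Metropolized non-equilibrium switches (`correction = ncmc-metropolis`) is exact

HONEST FRAMING: exact (Metropolis-corrected) sampling algorithms for lattice gauge theory;
figures of merit are autocorrelation/cost numbers at stated couplings and volumes; no
continuum-physics claim.

Venture `LatticeQCDFlow` (cell pub-lqcd), topic `Exactness`; FANOUT row 13 (`eng-snf`, GEN-8):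
the Lean companion of `latflow-snf` 0.1.9's `snf.ncmc` (the registry's third Metropolization of a
non-equilibrium protocol, next to `tempered-transitions` = `Exactness/TemperedTransitions.lean` and
`path-imh` = `Exactness/PathIMH.lean`).  NEW WORK of the cell (elementary finite sums), not a
published result; nothing here is cited as a fact.  Named only: J. P. Nilmeier, G. E. Crooks,
D. D. L. Minh, J. D. Chodera, PNAS 108 (2011) E1009 (non-equilibrium candidate Monte Carlo: a
driven switch accepted with a work-based Metropolis test); A. J. Ballard, C. Jarzynski, PNAS 106
(2009) 12224 (the same test for replica-exchange swaps); the expanded-ensemble / simulated-tempering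
reading (a chain on `{levels} × X`) is Lyubartsev et al. 1992 / Marinari–Parisi 1992 in spirit.
Row 8's `Exactness/NCMCAcceptance.lean` typed the ACCEPTANCE functional of the one-way switch at
`c = ΔF` (`acc = 1 − TV(P_F, P_R)`); this file types the SAMPLER: its kernel and its invariant law.

## Setting (tree vocabulary, nothing re-declared)

A protocol `S 0, …, S n : X → ℝ` on a finite configuration space with kernels `P k` leaving
`e^{-S (k+1)}` invariant (`IsStationary`; `Exactness/JarzynskiFinite.lean`: `transProb`, `work`,
`partitionFn`, `gibbsLaw`, `freeEnergy`); the reversed kernels `Theory2.revKernel` and the reverse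
path law `Theory2.revPathLaw` of `Scaling/StochasticFlows.lean` (stationarity only — the
1 HB + 4 OR sweeps of the SU(3) protocols are not reversible and nothing below needs them to be).
The SAMPLER (`snf.ncmc.run_ncmc_chain`) lives on `Bool × X`: level `false` = the PRIOR ensemble
`e^{-S 0}` (open defect / OBC), level `true` = the TARGET `e^{-S n}` (PBC), with a FIXED constant `c`
(log pseudo-prior weight of the target level).  From `(false, x)` it runs the forward protocol
`ω` (`ω 0 = x`) and moves to `(true, ω n)` with probability `min 1 e^{-(W(ω) − c)}`; from `(true, y)`
it runs the REVERSED kernels down the protocol (a path `ω` with `ω n = y`, reverse work `−W(ω)`) and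
moves to `(false, ω 0)` with probability `min 1 e^{W(ω) − c}`; otherwise it stays.

## Content

* `ncmcWeight c S (false, x) = e^{-S 0 x}`, `ncmcWeight c S (true, y) = e^{c} e^{-S n y}` — the
  (un-normalised) joint law the chain targets;
* `ncmc_pathwise` — the one identity everything rests on (Crooks, `Theory2.crooks_pathwise`):
  `e^{-S 0 (ω 0)} · Π_k P k · min 1 e^{-(W − c)} = e^{c} e^{-S n (ω n)} · Π_k P̂ k · min 1 e^{W − c}`
  for EVERY path `ω` — the forward proposal-and-accept weight of `ω` from the prior side equals the
  reverse one from the target side;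
* `ncmcMove` / `ncmcKernel` — the accepted-move weights between the levels (path sums with both
  end points pinned) and the full kernel (rejected mass on the diagonal);
  **`ncmcMove_detailedBalance`**, **`ncmcKernel_detailedBalance`**, `ncmcKernel_sum_eq_one`,
  **`ncmcKernel_isStationary`**: the switch kernel is in detailed balance with, hence leaves
  invariant, `ncmcWeight c S` — for EVERY `c`, every `n`, every interpolating family and every family
  of stationary kernels (no reversibility, no ergodicity, no tuning condition on `c`);
* (companion file `NCMCExpandedEnsembleKernel.lean`: `sum_fwdSwitch_le_one`, `sum_revSwitch_le_one`,
  `ncmcKernel_nonneg` — it is a Markov kernel; forward side: row-stochastic `P k`; reverse side: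
  stationarity alone, via `jarzynski_observable`);
* `levelKernel_isStationary` — relaxing at the current level with ANY `e^{-S 0}`- resp.
  `e^{-S n}`-stationary kernel (the engine's `n_sweeps_prior` / `n_sweeps_target` sweeps, or an exact
  re-draw) also leaves `ncmcWeight` invariant, hence (`ncmcIteration_isStationary`, via
  `isStationary_comp` of `Exactness/LocalUpdates.lean`) so does one iteration of `run_ncmc_chain` =
  relax ∘ switch;
* **`ncmc_occupancy`** — the stationary probability of the target level is
  `Σ_y w(true, y) / Σ w = 1 / (1 + e^{-(c − ΔF)})`, `ΔF = freeEnergy (S n) − freeEnergy (S 0)`: the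
  engine's run-time diagnostic (`meta.occupancy_target`, `dF_occ = c − logit(occupancy)`) and the
  reason `c` costs statistics, never exactness;
* **`ncmc_conditional_target`** — `w(true, y) / Σ_y' w(true, y') = gibbsLaw (S n) y`: conditioned
  on the target level the chain's law IS the target Gibbs law, for every `c` (the engine's
  estimator: plain averages over target-level samples = the chain watched on the target level).

Dictionary (engine `latflow-snf` ≥ 0.1.9, not proved here): `X` = a finite discretisation of the
link configurations, `P k` = `n_relax` composite 1 HB + `n_or` OR sweeps at `λ_{k+1}` (full lattice
or defect ball), deterministic SNF layers enter `W` through `− log|det J|` exactly as in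
`Exactness/StochasticFlows.lean` (a bijection of a finite space has unit Jacobian); hub-local
evidence tests t27–t29 (2-d U(1) exact oracle: plaquette, `⟨Q²⟩`, the occupancy law at three values
of `c − ΔF`, BAR of the switch works; planted pairing defects caught by the occupancy law at
> 60 σ; SU(2) 4⁴ through the latflow.core adapter).
-/

namespace Summit.Ventures.LatticeQCDFlow.Exactness

open Finset
open Literature.Probability.MarkovChains
open Summit.Ventures.LatticeQCDFlow.Theory2 (revKernel revPathLaw crooks_pathwise partitionFn_pos)

variable {X : Type*} [Fintype X] [DecidableEq X] {n : ℕ}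

/-! ## Objects -/

/-- The (un-normalised) joint weight on `Bool × X` targeted by the expanded-ensemble chain:
`e^{-S 0}` on the prior level `false`, `e^{c} · e^{-S n}` on the target level `true`. -/
noncomputable def ncmcWeight (c : ℝ) (S : Fin (n + 1) → X → ℝ) : Bool × X → ℝ
  | (false, x) => Real.exp (-S 0 x)
  | (true, y) => Real.exp c * Real.exp (-S (Fin.last n) y)

/-- Product of the REVERSED kernels along a path indexed by forward time (the proposal probability
of the reverse move, read from its start `ω n` down to `ω 0`):
`Π_k P̂ k (ω (k+1)) (ω k)`, `P̂ k = revKernel e^{-S (k+1)} (P k)`; so that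
`revPathLaw S P ω = gibbsLaw (S n) (ω n) · revTransProb S P ω` (`revPathLaw_eq`). -/
noncomputable def revTransProb (S : Fin (n + 1) → X → ℝ) (P : Fin n → X → X → ℝ)
    (ω : Fin (n + 1) → X) : ℝ :=
  ∏ k : Fin n, revKernel (fun x => Real.exp (-(S k.succ x))) (P k) (ω k.succ) (ω k.castSucc)

/-- Metropolis acceptance of the forward switch against the constant `c`: `min 1 e^{-(W − c)}`. -/
noncomputable def fwdAcc (c : ℝ) (S : Fin (n + 1) → X → ℝ) (ω : Fin (n + 1) → X) : ℝ :=
  min 1 (Real.exp (-(work S ω - c)))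

/-- Metropolis acceptance of the reverse switch (reverse work `−W`): `min 1 e^{W − c}`. -/
noncomputable def revAcc (c : ℝ) (S : Fin (n + 1) → X → ℝ) (ω : Fin (n + 1) → X) : ℝ :=
  min 1 (Real.exp (work S ω - c))

/-- Accepted forward-switch weight `x ↦ y`: over forward paths from `x` ending at `y`, the
probability of proposing the path times its acceptance. -/
noncomputable def fwdSwitch (c : ℝ) (S : Fin (n + 1) → X → ℝ) (P : Fin n → X → X → ℝ)
    (x y : X) : ℝ :=
  ∑ ω : Fin (n + 1) → X,
    if ω 0 = x ∧ ω (Fin.last n) = y then transProb P ω * fwdAcc c S ω else 0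

/-- Accepted reverse-switch weight `y ↦ x`: over paths with `ω n = y`, `ω 0 = x` (forward time),
the probability of proposing the reversed path from `y` times its acceptance. -/
noncomputable def revSwitch (c : ℝ) (S : Fin (n + 1) → X → ℝ) (P : Fin n → X → X → ℝ)
    (y x : X) : ℝ :=
  ∑ ω : Fin (n + 1) → X,
    if ω 0 = x ∧ ω (Fin.last n) = y then revTransProb S P ω * revAcc c S ω else 0

/-- Accepted-move weights of the expanded-ensemble chain: forward switches from the prior level,
reverse switches from the target level, nothing within a level. -/
noncomputable def ncmcMove (c : ℝ) (S : Fin (n + 1) → X → ℝ) (P : Fin n → X → X → ℝ) :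
    Bool × X → Bool × X → ℝ
  | (false, x), (true, y) => fwdSwitch c S P x y
  | (true, y), (false, x) => revSwitch c S P y x
  | _, _ => 0

/-- The full switch kernel: accepted moves plus the rejected mass on the diagonal. -/
noncomputable def ncmcKernel (c : ℝ) (S : Fin (n + 1) → X → ℝ) (P : Fin n → X → X → ℝ)
    (s s' : Bool × X) : ℝ :=
  ncmcMove c S P s s' + if s' = s then 1 - ∑ t, ncmcMove c S P s t else 0

/-- Level-wise relaxation: a kernel `T₀` on the prior level, `T₁` on the target level. -/
def levelKernel (T₀ T₁ : X → X → ℝ) : Bool × X → Bool × X → ℝ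
  | (false, x), (false, x') => T₀ x x'
  | (true, y), (true, y') => T₁ y y'
  | _, _ => 0

/-! ## Crooks, in the form the sampler uses -/

omit [DecidableEq X] in
/-- `revPathLaw = gibbsLaw (S n) (ω n) · revTransProb` (definitional bookkeeping). -/
theorem revPathLaw_eq (S : Fin (n + 1) → X → ℝ) (P : Fin n → X → X → ℝ) (ω : Fin (n + 1) → X) :
    revPathLaw S P ω = gibbsLaw (S (Fin.last n)) (ω (Fin.last n)) * revTransProb S P ω := rfl

omit [DecidableEq X] in
/-- Crooks' pathwise identity with un-normalised end weights:
`e^{-S 0 (ω 0)} · Π P · e^{-W(ω)} = e^{-S n (ω n)} · Π P̂` (stationarity of each `P k` only). -/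
theorem crooks_unnormalised [Nonempty X] (S : Fin (n + 1) → X → ℝ) (P : Fin n → X → X → ℝ)
    (ω : Fin (n + 1) → X) :
    Real.exp (-S 0 (ω 0)) * transProb P ω * Real.exp (-(work S ω)) =
      Real.exp (-S (Fin.last n) (ω (Fin.last n))) * revTransProb S P ω := by
  have hc := crooks_pathwise S P ω
  have hZ0 : partitionFn (S 0) ≠ 0 := (partitionFn_pos (S 0)).ne'
  have hZn : partitionFn (S (Fin.last n)) ≠ 0 := (partitionFn_pos (S (Fin.last n))).ne'
  rw [revPathLaw_eq] at hc
  unfold pathLaw gibbsLaw at hc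
  calc Real.exp (-S 0 (ω 0)) * transProb P ω * Real.exp (-(work S ω))
      = partitionFn (S 0) *
          (Real.exp (-S 0 (ω 0)) / partitionFn (S 0) * transProb P ω * Real.exp (-(work S ω))) := by
        field_simp
    _ = partitionFn (S 0) * (partitionFn (S (Fin.last n)) / partitionFn (S 0) *
          (Real.exp (-S (Fin.last n) (ω (Fin.last n))) / partitionFn (S (Fin.last n)) *
            revTransProb S P ω)) := by rw [hc]
    _ = Real.exp (-S (Fin.last n) (ω (Fin.last n))) * revTransProb S P ω := by
        field_simp

omit [DecidableEq X] in
/-- **The pathwise balance of the Metropolized switch.**  For EVERY path `ω` and EVERY constant `c`: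
`e^{-S 0 (ω 0)} · Π P(ω) · min 1 e^{-(W − c)} = e^{c} e^{-S n (ω n)} · Π P̂(ω) · min 1 e^{W − c}` —
the prior-side weight of proposing `ω` forward and accepting equals the target-side weight of
proposing it backward and accepting. -/
theorem ncmc_pathwise [Nonempty X] (c : ℝ) (S : Fin (n + 1) → X → ℝ) (P : Fin n → X → X → ℝ)
    (ω : Fin (n + 1) → X) :
    Real.exp (-S 0 (ω 0)) * transProb P ω * fwdAcc c S ω =
      Real.exp c * Real.exp (-S (Fin.last n) (ω (Fin.last n))) * revTransProb S P ω * revAcc c S ω := by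
  have key := crooks_unnormalised S P ω
  -- `min 1 e^{-(W-c)} = e^{-W} · min e^{W} e^{c}` and `e^{c} · min 1 e^{W-c} = min e^{W} e^{c}`
  have h1 : fwdAcc c S ω = Real.exp (-(work S ω)) * min (Real.exp (work S ω)) (Real.exp c) := by
    unfold fwdAcc
    rw [mul_min_of_nonneg _ _ (Real.exp_pos _).le, ← Real.exp_add, ← Real.exp_add, neg_add_cancel,
      Real.exp_zero]
    congr 1
    congr 1
    ring
  have h2 : Real.exp c * revAcc c S ω = min (Real.exp (work S ω)) (Real.exp c) := by
    unfold revAcc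
    rw [mul_min_of_nonneg _ _ (Real.exp_pos _).le, mul_one, ← Real.exp_add, min_comm]
    congr 1
    congr 1
    ring
  calc Real.exp (-S 0 (ω 0)) * transProb P ω * fwdAcc c S ω
      = (Real.exp (-S 0 (ω 0)) * transProb P ω * Real.exp (-(work S ω))) *
          min (Real.exp (work S ω)) (Real.exp c) := by rw [h1]; ring
    _ = (Real.exp (-S (Fin.last n) (ω (Fin.last n))) * revTransProb S P ω) *
          (Real.exp c * revAcc c S ω) := by rw [key, h2]
    _ = Real.exp c * Real.exp (-S (Fin.last n) (ω (Fin.last n))) * revTransProb S P ω *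
          revAcc c S ω := by ring

/-! ## Detailed balance and invariance of the switch kernel -/

/-- Between the levels: `e^{-S 0 x} · F(x → y) = e^{c} e^{-S n y} · R(y → x)` (sum `ncmc_pathwise`
over the paths pinned at both ends). -/
theorem fwdSwitch_balance [Nonempty X] (c : ℝ) (S : Fin (n + 1) → X → ℝ)
    (P : Fin n → X → X → ℝ) (x y : X) :
    Real.exp (-S 0 x) * fwdSwitch c S P x y =
      Real.exp c * Real.exp (-S (Fin.last n) y) * revSwitch c S P y x := by
  unfold fwdSwitch revSwitch
  rw [mul_sum, mul_sum]
  refine sum_congr rfl fun ω _ => ?_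
  by_cases h : ω 0 = x ∧ ω (Fin.last n) = y
  · rw [if_pos h, if_pos h, ← h.1, ← h.2, ← mul_assoc, ncmc_pathwise c S P ω]
    ring
  · rw [if_neg h, if_neg h, mul_zero, mul_zero]

/-- **Detailed balance of the accepted moves** with respect to `ncmcWeight c S`, for every `c`. -/
theorem ncmcMove_detailedBalance [Nonempty X] (c : ℝ) (S : Fin (n + 1) → X → ℝ)
    (P : Fin n → X → X → ℝ) : DetailedBalance (ncmcWeight c S) (ncmcMove c S P) := by
  rintro ⟨b, x⟩ ⟨b', y⟩
  cases b <;> cases b'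
  · simp [ncmcMove]
  · simp only [ncmcWeight, ncmcMove]
    exact fwdSwitch_balance c S P x y
  · simp only [ncmcWeight, ncmcMove]
    exact (fwdSwitch_balance c S P y x).symm
  · simp [ncmcMove]

/-- The rows of the switch kernel sum to one. -/
theorem ncmcKernel_sum_eq_one (c : ℝ) (S : Fin (n + 1) → X → ℝ) (P : Fin n → X → X → ℝ)
    (s : Bool × X) : ∑ s', ncmcKernel c S P s s' = 1 := by
  unfold ncmcKernel
  rw [sum_add_distrib, sum_ite_eq' univ s, if_pos (mem_univ s)]
  ring

/-- **Detailed balance of the switch kernel** with respect to `ncmcWeight c S`. -/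
theorem ncmcKernel_detailedBalance [Nonempty X] (c : ℝ) (S : Fin (n + 1) → X → ℝ)
    (P : Fin n → X → X → ℝ) : DetailedBalance (ncmcWeight c S) (ncmcKernel c S P) := by
  intro s s'
  unfold ncmcKernel
  have hM := ncmcMove_detailedBalance c S P s s'
  by_cases hss : s' = s
  · subst hss
    rfl
  · have hss' : ¬s = s' := fun h => hss h.symm
    rw [if_neg hss, if_neg hss', add_zero, add_zero]
    exact hM

/-- **Exactness of the expanded-ensemble NCMC chain (E-class statement of the venture; the
`ncmc-metropolis` mode of `latflow-snf`).**  The switch kernel leaves `ncmcWeight c S` invariant —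
for EVERY constant `c`, every number of steps, every interpolating family of actions and every
family of kernels each stationary for its own Boltzmann weight. -/
theorem ncmcKernel_isStationary [Nonempty X] (c : ℝ) (S : Fin (n + 1) → X → ℝ)
    (P : Fin n → X → X → ℝ) : IsStationary (ncmcWeight c S) (ncmcKernel c S P) :=
  (ncmcKernel_detailedBalance c S P).isStationary (ncmcKernel_sum_eq_one c S P)

/-! ## Level-wise relaxation and composition -/

omit [DecidableEq X] in
/-- Relaxing at the current level with kernels stationary for that level's Boltzmann weight leaves
the joint weight invariant (for every `c`). -/
theorem levelKernel_isStationary (c : ℝ) (S : Fin (n + 1) → X → ℝ) (T₀ T₁ : X → X → ℝ)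
    (h₀ : IsStationary (fun x => Real.exp (-S 0 x)) T₀)
    (h₁ : IsStationary (fun x => Real.exp (-S (Fin.last n) x)) T₁) :
    IsStationary (ncmcWeight c S) (levelKernel T₀ T₁) := by
  rintro ⟨b, y⟩
  rw [Fintype.sum_prod_type, Fintype.sum_bool]
  cases b
  · simp only [ncmcWeight, levelKernel, mul_zero, sum_const_zero, zero_add]
    exact h₀ y
  · simp only [ncmcWeight, levelKernel, mul_zero, sum_const_zero, add_zero]
    have := h₁ y
    calc ∑ x, Real.exp c * Real.exp (-S (Fin.last n) x) * T₁ x y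
        = Real.exp c * ∑ x, Real.exp (-S (Fin.last n) x) * T₁ x y := by
          rw [mul_sum]
          exact sum_congr rfl fun x _ => mul_assoc _ _ _
      _ = Real.exp c * Real.exp (-S (Fin.last n) y) := by rw [this]

/-- **One iteration of the sampler is exact**: relaxing at the level (`levelKernel`, kernels
stationary for their own Boltzmann weights) followed by the Metropolized switch leaves
`ncmcWeight c S` invariant (`compKernel` / `isStationary_comp` of `Exactness/LocalUpdates.lean`). -/
theorem ncmcIteration_isStationary [Nonempty X] (c : ℝ) (S : Fin (n + 1) → X → ℝ)
    (P : Fin n → X → X → ℝ) (T₀ T₁ : X → X → ℝ)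
    (h₀ : IsStationary (fun x => Real.exp (-S 0 x)) T₀)
    (h₁ : IsStationary (fun x => Real.exp (-S (Fin.last n) x)) T₁) :
    IsStationary (ncmcWeight c S) (compKernel (levelKernel T₀ T₁) (ncmcKernel c S P)) :=
  isStationary_comp (levelKernel_isStationary c S T₀ T₁ h₀ h₁) (ncmcKernel_isStationary c S P)

/-! ## What the run-time diagnostics read -/

omit [DecidableEq X] in
/-- Mass of the target level: `Σ_y w(true, y) = e^{c} · Z n`. -/
theorem sum_ncmcWeight_true (c : ℝ) (S : Fin (n + 1) → X → ℝ) :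
    ∑ y, ncmcWeight c S (true, y) = Real.exp c * partitionFn (S (Fin.last n)) := by
  simp only [ncmcWeight, partitionFn, mul_sum]

omit [DecidableEq X] in
/-- Mass of the prior level: `Σ_x w(false, x) = Z 0`. -/
theorem sum_ncmcWeight_false (c : ℝ) (S : Fin (n + 1) → X → ℝ) :
    ∑ x, ncmcWeight c S (false, x) = partitionFn (S 0) := by
  simp only [ncmcWeight, partitionFn]

omit [DecidableEq X] in
/-- **The occupancy law.**  The stationary probability of the target level is
`1 / (1 + e^{-(c − ΔF)})`, `ΔF = freeEnergy (S n) − freeEnergy (S 0)` — equal occupation iff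
`c = ΔF`; the engine reads `dF_occ = c − logit(occupancy)` off it. -/
theorem ncmc_occupancy [Nonempty X] (c : ℝ) (S : Fin (n + 1) → X → ℝ) :
    (∑ y, ncmcWeight c S (true, y)) / (∑ s, ncmcWeight c S s) =
      1 / (1 + Real.exp (-(c - (freeEnergy (S (Fin.last n)) - freeEnergy (S 0))))) := by
  have hZ0 : 0 < partitionFn (S 0) := partitionFn_pos (S 0)
  have hZn : 0 < partitionFn (S (Fin.last n)) := partitionFn_pos (S (Fin.last n))
  rw [Fintype.sum_prod_type, Fintype.sum_bool, sum_ncmcWeight_true, sum_ncmcWeight_false]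
  have hE : Real.exp (-(c - (freeEnergy (S (Fin.last n)) - freeEnergy (S 0)))) =
      partitionFn (S 0) / (Real.exp c * partitionFn (S (Fin.last n))) := by
    unfold freeEnergy
    rw [show -(c - (-Real.log (partitionFn (S (Fin.last n))) - -Real.log (partitionFn (S 0)))) =
        Real.log (partitionFn (S 0)) - (c + Real.log (partitionFn (S (Fin.last n)))) by ring,
      Real.exp_sub, Real.exp_add, Real.exp_log hZ0, Real.exp_log hZn]
  rw [hE]
  have hpos : 0 < Real.exp c * partitionFn (S (Fin.last n)) := mul_pos (Real.exp_pos c) hZn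
  field_simp

omit [DecidableEq X] in
/-- **Conditioned on the target level the law is the target Gibbs law**, for every `c`: the
chain watched on the target level samples `gibbsLaw (S n)` — the engine's estimator. -/
theorem ncmc_conditional_target (c : ℝ) (S : Fin (n + 1) → X → ℝ) (y : X) :
    ncmcWeight c S (true, y) / (∑ y', ncmcWeight c S (true, y')) = gibbsLaw (S (Fin.last n)) y := by
  rw [sum_ncmcWeight_true]
  simp only [ncmcWeight, gibbsLaw]
  rw [mul_div_mul_left _ _ (Real.exp_pos c).ne']

omit [DecidableEq X] in
/-- … and conditioned on the prior level it is the prior Gibbs law. -/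
theorem ncmc_conditional_prior (c : ℝ) (S : Fin (n + 1) → X → ℝ) (x : X) :
    ncmcWeight c S (false, x) / (∑ x', ncmcWeight c S (false, x')) = gibbsLaw (S 0) x := by
  rw [sum_ncmcWeight_false]
  simp only [ncmcWeight, gibbsLaw]

end Summit.Ventures.LatticeQCDFlow.Exactness
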